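import Literature.NumberTheory.DiophantineApproximation.GeneralizedPolynomialsUDPropOneTwo
import Literature.NumberTheory.DiophantineApproximation.GeneralizedPolynomialsUDSufficiency
import HarnessLib

/-!
# Håland 1994, Proposition 1.2 — the corrected statement (`α, β > 0`), proved

Topic `Literature/NumberTheory/DiophantineApproximation`, next to the statement file
`GeneralizedPolynomialsUD.lean`. That file vendors Proposition 1.2 of I. J. Håland, *Uniform
distribution of generalized polynomials of the product type*, Acta Arith. 67 (1994) 13–27, p. 13
(= Håland 1993, J. Number Theory 45, Prop. 5.3), literally, over all non-zero `α, β`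
(`Haland1994_prop_1_2`), and REFUTES that literal reading (`not_Haland1994_prop_1_2`: for
`α/β < 0` condition (i) "`α/β ≠ √c` for all `c ∈ ℚ₊`" is vacuous in `c`, and e.g.
`(α, β, γ) = (√2, −1, √2)` is not u.d. although (i) holds). The printed dichotomy
"`α/β = √c` for some `c ∈ ℚ₊`" / "`α/β ≠ √c` for all `c ∈ ℚ₊`" presupposes a POSITIVE ratio, the
regime of the paper's standing examples; this file records the statement in that regime under a
new name, `Haland1994_prop_1_2_pos` (hypotheses `0 < α`, `0 < β`; otherwise verbatim the vendored
text), and DISCHARGES it: `Haland1994_prop_1_2_pos_holds`, from the two directions proved in the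
tree, `Haland1994_prop_1_2_necessity` (`GeneralizedPolynomialsUDPropOneTwo.lean`) and
`Haland1994_prop_1_2_sufficiency` (`GeneralizedPolynomialsUDSufficiency.lean`).

(For `αβ < 0` the natural reading replaces `α/β` by `|α/β|`; that variant is not printed and not
recorded here.)

## References

* [Haland1994] I. J. Håland, *Uniform distribution of generalized polynomials of the product type*,
  Acta Arith. 67 (1994) 13–27, Prop. 1.2 (p. 13). doi:10.4064/aa-67-1-13-27
* I. J. Håland, *Uniform distribution of generalized polynomials*, J. Number Theory 45 (1993)
  327–366, Prop. 5.3 (the source of Prop. 1.2, cited through [Haland1994]).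
-/

noncomputable section

namespace Literature.NumberTheory.DiophantineApproximation

/-- **Håland 1994, Proposition 1.2, for positive `α, β`** (the corrected vendoring of
`Haland1994_prop_1_2`, whose literal reading over all non-zero `α, β` is refuted by
`not_Haland1994_prop_1_2`): for reals `α, β > 0` and `γ`, "the generalized polynomial `[αn][βn]γ`
is uniformly distributed (mod 1) if and only if one of the following conditions hold:
(i) `α/β ≠ √c` for all `c ∈ ℚ₊` and `γ` is irrational; (ii) `α/β = √c` for some `c ∈ ℚ₊` and `γ`
is rationally independent of `1, √c`" (rendered `γ ∉ span_ℚ{1, √c}`, the printed meaning also when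
`√c ∈ ℚ`). The discrepancy with the vendored `Haland1994_prop_1_2` is only the hypothesis
`0 < α, 0 < β` in place of `α ≠ 0, β ≠ 0`: the printed dichotomy (i)/(ii) presupposes a positive
ratio `α/β`. Proved below (`Haland1994_prop_1_2_pos_holds`). [cite: Haland1994, Prop. 1.2] -/
def Haland1994_prop_1_2_pos : Prop :=
  ∀ α β γ : ℝ, 0 < α → 0 < β →
    (IsUDModOne (fun n : ℕ => (⌊α * n⌋ : ℝ) * (⌊β * n⌋ : ℝ) * γ) ↔
      ((∀ c : ℚ, 0 < c → α / β ≠ Real.sqrt c) ∧ Irrational γ) ∨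
        (∃ c : ℚ, 0 < c ∧ α / β = Real.sqrt c ∧
          γ ∉ Submodule.span ℚ ({1, Real.sqrt c} : Set ℝ)))

/-- **Discharge of `Haland1994_prop_1_2_pos`**: both directions are theorems of the tree,
`Haland1994_prop_1_2_necessity` and `Haland1994_prop_1_2_sufficiency`.
[cite: Haland1994, Prop. 1.2] -/
theorem Haland1994_prop_1_2_pos_holds : Haland1994_prop_1_2_pos :=
  fun _ _ _ hα hβ =>
    ⟨Haland1994_prop_1_2_necessity hα hβ, fun h => Haland1994_prop_1_2_sufficiency hα hβ h⟩

end Literature.NumberTheory.DiophantineApproximation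

end
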